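import Summits.ABC.IUTFork.Cor312GluedMonoidsReading3
import HarnessLib

/-!
# Companion of `Cor312GluedMonoidsReading3`: the data-dependent form — a region ALGORITHM functorial under the indeterminacy moves

Proof-only file (D-0012; abc-iut cell, wave 5, seat abc-iut-w5-d230; check (B) informative form, director-abc 00:45:37Z (3), design
abc-iut-w5-d220 00:29:01Z). TAKES NO SIDE on [IUTchIII] Cor. 3.12; no `Prop` fact, 0 defs. In `Cor312GluedMonoidsReading3` the
region-forming operator `ρ` is data-independent and EQUIVARIANT. Here the region attached to splitting-monoid data may depend on the
line datum it is read against (`MRData`: integral structures, actions, number fields) and the hypothesis is FUNCTORIALITY under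
the indeterminacy moves, `α (D.map Φ) (Φ·Ψ) = Φ '' α D Ψ` — after [IUTchIII] Thm. 3.11 (i), kurims p. 154 l. 67–69 of this seat's
render `paper:url-4b091feeb646`: "an algorithm in the procession of D^⊢-prime-strips […] that is functorial with respect to
isomorphisms of processions of D^⊢-prime-strips". Same conclusions: READING R3, its sharpness, and the printed Statement of Cor. 3.12
from Theorem 3.11 AS TYPED + `BridgeHyps` + the glues. [claim: Mochizuki2012, status: disputed]
-/

noncomputable section

open Set

namespace Summit.ABC.IUTFork.Cor312Vol.GluedMonoids

open Thm311 Cor312 Literature.IUT.LogThetaLattice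

variable {T : ThetaIndex}

/-! ## The data-dependent form: a region ALGORITHM functorial under the indeterminacy moves -/

section Functorial

variable (S : LatticeSituation T) (P : Cor312.Setting S.toSituation)
  (α : MRData S.L → (∀ v : T.V, v ∈ T.Vbad → Set (S.L.StarPacket v)) → ∀ (j : T.Label) (vQ : T.VQ), Set (S.L.Packet j vQ))

/-- **READING R3 from a FUNCTORIAL region algorithm.** Here the region attached to splitting-monoid data may depend on the line datum
`D` it is read against (its integral structures, actions, number fields: `MRData`), and the hypothesis is FUNCTORIALITY under the
indeterminacy moves — `α (D.map Φ) (Φ·Ψ) = Φ '' α D Ψ` for `Φ ∈ ⟨(Ind1) ∪ (Ind2)⟩` (after Thm. 3.11 (i), p. 154 l. 67–69: "an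
algorithm in the procession of D^⊢-prime-strips […] that is functorial with respect to isomorphisms of processions of
D^⊢-prime-strips") — instead of equivariance of a data-independent operator (§3 is
the special case `α D := ρ`). With the Θ-glue (b1ᵅ) `thetaRegion m = α (S.D n) ((S.col n).frobΨ m)`, Thm. 3.11 (ii) (b) for column
`n`, and the q-glue (b2ᵅ) `qRegion = α D' D'.Ψ` for some possible image `D' ∈ ^{n,∘}R^LGP` read AGAINST ITSELF, READING R3 holds.
[claim: Mochizuki2012, status: disputed] -/
theorem qRegion_mem_possibleImages_of_functorialGlue
    (hα : ∀ Φ ∈ Subgroup.closure (S.L.Ind1Family ∪ S.L.Ind2Family), ∀ (D : MRData S.L)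
      (Ψ : ∀ v : T.V, v ∈ T.Vbad → Set (S.L.StarPacket v)) (j : T.Label) (vQ : T.VQ),
        α (D.map Φ) (fun v hv => S.L.starAut Φ v '' Ψ v hv) j vQ = Φ j vQ '' α D Ψ j vQ)
    (hKumB : (S.col P.n).KummerB (S.D P.n))
    (hb1 : ∀ (m : ℤ) (j : T.Label) (vQ : T.VQ), P.thetaRegion m j vQ = α (S.D P.n) ((S.col P.n).frobΨ m) j vQ)
    {D' : MRData S.L} (hD' : D' ∈ S.RLGP P.n)
    (hb2 : ∀ (j : T.Label) (vQ : T.VQ), P.qRegion j vQ = α D' D'.Ψ j vQ) :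
    ∀ (j : T.Label) (vQ : T.VQ), P.qRegion j vQ ∈ P.possibleImages j vQ := by
  obtain ⟨Φ, hΦ, rfl⟩ := (MRData.mem_RLGP_iff (S.D P.n) D').1 hD'
  intro j vQ
  refine ⟨Φ, hΦ, ?_⟩
  rw [hb2, thetaRegion3_eq_of_glue S P (α (S.D P.n)) hKumB hb1]
  exact hα Φ hΦ (S.D P.n) (S.D P.n).Ψ j vQ

/-- … and, as in §5, there is no slack: under (hα), (b1ᵅ), (ii) (b), READING R3 at `(j, v_ℚ)` ⟺ the q-region there is `α D' D'.Ψ`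
for some possible image `D'` of the line-`n` data. [claim: Mochizuki2012, status: disputed] -/
theorem qRegion_mem_possibleImages_iff_functorialGlue
    (hα : ∀ Φ ∈ Subgroup.closure (S.L.Ind1Family ∪ S.L.Ind2Family), ∀ (D : MRData S.L)
      (Ψ : ∀ v : T.V, v ∈ T.Vbad → Set (S.L.StarPacket v)) (j : T.Label) (vQ : T.VQ),
        α (D.map Φ) (fun v hv => S.L.starAut Φ v '' Ψ v hv) j vQ = Φ j vQ '' α D Ψ j vQ)
    (hKumB : (S.col P.n).KummerB (S.D P.n))
    (hb1 : ∀ (m : ℤ) (j : T.Label) (vQ : T.VQ), P.thetaRegion m j vQ = α (S.D P.n) ((S.col P.n).frobΨ m) j vQ)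
    (j : T.Label) (vQ : T.VQ) :
    P.qRegion j vQ ∈ P.possibleImages j vQ ↔ ∃ D' ∈ S.RLGP P.n, P.qRegion j vQ = α D' D'.Ψ j vQ := by
  constructor
  · rintro ⟨Φ, hΦ, hq⟩
    refine ⟨(S.D P.n).map Φ, MRData.map_mem_RLGP (S.D P.n) hΦ, ?_⟩
    rw [hq, thetaRegion3_eq_of_glue S P (α (S.D P.n)) hKumB hb1]
    exact (hα Φ hΦ (S.D P.n) (S.D P.n).Ψ j vQ).symm
  · rintro ⟨D', hD', hq⟩
    obtain ⟨Φ, hΦ, rfl⟩ := (MRData.mem_RLGP_iff (S.D P.n) D').1 hD'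
    refine ⟨Φ, hΦ, ?_⟩
    rw [hq, thetaRegion3_eq_of_glue S P (α (S.D P.n)) hKumB hb1]
    exact hα Φ hΦ (S.D P.n) (S.D P.n).Ψ j vQ

/-- The link-faithful instance of the functorial form, from Theorem 3.11 AS TYPED: (b2ᵅ′) the q-region of column `n` is the region
the algorithm assigns to the PREVIOUS line's datum `^{n−1,∘}(−)` and the Frobenius-like Θ-splitting monoid of column `n − 1` at
`(n−1, m₀)` (paraphrase of (xi-a) p. 181 l. 36–41); with `BridgeHyps`, the printed Statement of Cor. 3.12 follows.
[claim: Mochizuki2012, status: disputed] -/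
theorem statement_of_thm311_of_functorialLinkedColumn (S : FullSituation T)
    (P : Cor312.Setting S.toLatticeSituation.toSituation)
    (α : MRData S.L → (∀ v : T.V, v ∈ T.Vbad → Set (S.L.StarPacket v)) → ∀ (j : T.Label) (vQ : T.VQ), Set (S.L.Packet j vQ))
    (hThm : S.Statement) (H : BridgeHyps P)
    (hα : ∀ Φ ∈ Subgroup.closure (S.L.Ind1Family ∪ S.L.Ind2Family), ∀ (D : MRData S.L)
      (Ψ : ∀ v : T.V, v ∈ T.Vbad → Set (S.L.StarPacket v)) (j : T.Label) (vQ : T.VQ),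
        α (D.map Φ) (fun v hv => S.L.starAut Φ v '' Ψ v hv) j vQ = Φ j vQ '' α D Ψ j vQ)
    (hb1 : ∀ (m : ℤ) (j : T.Label) (vQ : T.VQ), P.thetaRegion m j vQ = α (S.D P.n) ((S.col P.n).frobΨ m) j vQ)
    (m₀ : ℤ) (hb2 : ∀ (j : T.Label) (vQ : T.VQ), P.qRegion j vQ = α (S.D (P.n - 1)) ((S.col (P.n - 1)).frobΨ m₀) j vQ) :
    P.Statement := by
  have hΨ : (S.col (P.n - 1)).frobΨ m₀ = (S.D (P.n - 1)).Ψ :=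
    funext fun v => funext fun hv => kummerB_of_statement S hThm (P.n - 1) m₀ v hv
  refine statement_of_qRegion_mem_possibleImages H fun i vQ => ?_
  refine qRegion_mem_possibleImages_of_functorialGlue S.toLatticeSituation P α hα (kummerB_of_statement S hThm P.n) hb1
    (S.mem_RLGP_of_multiradialCompat (multiradialCompat_of_statement S hThm) P.n (P.n - 1)) (fun j vQ => ?_) _ vQ
  rw [hb2, hΨ]

end Functorial


end Summit.ABC.IUTFork.Cor312Vol.GluedMonoids

end
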